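/-
Copyright (c) 2026 the pub-hodgecm-mathlib formalisation cell (harness21).  Prover seat hodgecm-mathlib-K2Liu-p14 (g0): Track B «K2-LIT»,
hLiu418 = stmt-HodgeConjecture-24832; RULINGS M-156m ∕ M-156o «A7 = GK COCYCLE ROAD», co-dealer K2E5-plan (g6) 08:19:27Z (1), file B2 (re-scoped).
-/
import Summits.HodgeConjecture.HodgeConjecture.Theorems.K2LiuQRationalLFactor          -- ★ (a): `isQRationalRegularAt_qVar_zpow`, `residueFieldCard_placesOver_eq_pow`; ★ F1, ★ T1
import Summits.HodgeConjecture.HodgeConjecture.Theorems.K2LiuLocalSiegelCharacterMul     -- ★ #7c: `isUnit_detDelta`, `localSiegelCharacter_mul`; ★ K2Lit D1 `IsLocalSiegelSection`, `IsSmooth`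
import Literature.NumberTheory.Automorphic.AddCharConductorExponent                       -- ★ `exists_normAbs_eq_inv_zpow`, `normAbs_eq_inv_zpow_of_valued_eq`
import HarnessLib

/-!
# Crux `HLiu418`, road `K2_Liu`, organ A7-reg (GK cocycle road), file B2 (re-scoped under RULING M-156o):
# FLAT FAMILIES OF SIEGEL SECTIONS — one level for the whole family, and every value is a `q_v^{-s}`-monomial

Cell `hodgecm-mathlib`, crux item hLiu418 = `stmt-HodgeConjecture-24832`; squad K2 ∕ K2Liu; prover K2Liu-p14 (g0).
THEOREMS ONLY (no `def`, no instance, no notation, no named-fact hypothesis, no `sorry`); lane `--supports stmt-HodgeConjecture-24832`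
(count-neutral helper).  FRAME-FREE and RANK-GENERIC: general quadratic `E/F`, any finite place `v`, any `n`, the tree's local doubled group
`H_v = ★ UnitaryGroup.localPi E c (n+n) J^𝔻 v` with its Siegel parabolic `P_Δ(F_v)` = ★ `IsSiegelDelta` and the degenerate principal series
`I_v(s, χ_v)` of ★ K2Lit `DoubledUnitaryDegeneratePrincipalSeries` (`IsLocalSiegelSection`, `IsSmooth`, `localSiegelCharacter`).

THE ROLE OF THIS FILE.  The repaired face (A4′-R) (`FaceA4primeR`, RULING M-156m′) quantifies over FLAT FAMILIES `f : ℂ → H_v → ℂ` of smooth Siegel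
sections — `f s ∈ I_v(s, χ_v)` for every `s`, with `s`-independent restriction to an open compact `K₀ ≤ H_v` satisfying the Iwasawa decomposition
`H_v = P_Δ(F_v)·K₀`.  STEP 0 of the Gindikin–Karpelevich cocycle (B4∕B7, K2Liu-p09 (g5)) feeds such a family to the abstract rank-one operator
(★ `K2LiuRankOneOperators`) and to the bookkeeper (★ B6 `K2LiuRankOneFamilies[Level]`), which want, BY NAME:
* ONE right-invariance level `K′` for ALL `s` (`hfK : ∀ g, ∀ k ∈ K′, f s (g k) = f s g`) — §3 `exists_uniform_level`: `K′ := K₀ ⊓ U` where `U` is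
  any smoothness group of ONE member `f s₁` (flatness on `K₀` + the Siegel law transport it to every `s`); in particular each `f s` is smooth;
* EVERY value family `s ↦ f s h` `q_v^{-s}`-rational and regular at EVERY `s₀` — §3 `isQRationalRegularAt_apply_of_flat`: `h = p k` (Iwasawa),
  `f s (p k) = localSiegelCharacter χ_v s p · f s₁ k` and `s ↦ localSiegelCharacter χ_v s p = χ_v(det_Δ p) · |det_Δ p|_v^{s + n/2}` is a LAURENT
  MONOMIAL in `X = q_v^{-s}` (§2: `|det_Δ p|_v = Π_{w∣v} ‖det_Δ p_w‖_w ∈ q_v^ℤ`, since `‖·‖_w ∈ q_w^ℤ` on `E_wˣ` and `q_w = q_v^{f(w|v)}`) — this is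
  rider (R2) of K2E5-plan (g6) 08:08:42Z: representative values are stated directly in ★ F1's `IsQRationalRegularAt` currency.
§1 is the base-`q` complex analysis: `((q^K : ℝ) : ℂ)^z = q^{K z}` and `s ↦ ((q^K : ℝ) : ℂ)^{s + c₀} = q^{K c₀} · X^{−K}` regular everywhere.
HONEST LABEL.  `HC_CM` is proved only modulo the 7 printed citations (2 remaining named inputs: hLiu418 = `stmt-HodgeConjecture-24832`,
h413 = `stmt-HodgeConjecture-24833`) until rung 0 closes.

## References
* [KudlaSweet1997] S. Kudla, W. J. Sweet, Israel J. Math. 98 (1997), §1 (standard = `K`-flat sections of `I(s, χ)`; rationality in `q^{-s}`).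
* [HarrisKudlaSweet1996] M. Harris, S. Kudla, W. J. Sweet, J. Amer. Math. Soc. 9 (1996), §1 (1.15) (`χ(x(p))|x(p)|^{s+ρ}`, standard sections).
* [Casselman1980] W. Casselman, Compositio Math. 40 (1980), §3 (rationality in `q^{-s}` on `K′`-fixed vectors).
* [BushnellHenniart2006] C. J. Bushnell, G. Henniart, *The local Langlands conjecture for GL(2)* (2006), §1.1 (smooth vectors, level).
-/

set_option autoImplicit false
set_option linter.dupNamespace false -- the mandated namespace repeats `HodgeConjecture.HodgeConjecture`

noncomputable section

open Polynomial NumberField IsDedekindDomain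
open scoped NNReal
open Literature.NumberTheory.GaloisRepresentations Literature.NumberTheory.GaloisRepresentations.IsNonarchimedeanLocalField
open Literature.NumberTheory.Automorphic Literature.NumberTheory.Automorphic.UnitaryGroup
open Literature.NumberTheory.GelbartRogawski1991.UnitaryDualPair.LocalSplitting
open Literature.NumberTheory.K2Lit.LocalSiegelDoubled
open Summit.HodgeConjecture.HodgeConjecture.Cruxes.HLiu418.K2LiuQRationalDefs
open Summit.HodgeConjecture.HodgeConjecture.Cruxes.HLiu418.K2LiuQRationalLFactor
open Summit.HodgeConjecture.HodgeConjecture.Cruxes.HLiu418.K2LiuLocalSiegel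

namespace Summit.HodgeConjecture.HodgeConjecture.Cruxes.HLiu418.K2LiuFlatSiegelFamilies

/-! ## §1 Base `q`: `((q^K : ℝ) : ℂ)^z = q^{K z}` and the Laurent monomial `s ↦ (q^K)^{s + c₀}` -/

section Generic

variable {q : ℕ}

/-- `((q^K : ℝ) : ℂ) = (q : ℂ)^K` (`K ∈ ℤ`). [folklore] -/
theorem ofReal_natCast_zpow (q : ℕ) (K : ℤ) : (((q : ℝ) ^ K : ℝ) : ℂ) = (q : ℂ) ^ K := by
  rw [Complex.ofReal_zpow, Complex.ofReal_natCast]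

/-- **`((q : ℂ)^K)^z = q^{K·z}`** for a natural base (`arg q = 0`, so no branch issue; Mathlib `Complex.cpow_int_mul'`). [folklore] -/
theorem natCast_zpow_cpow (q : ℕ) (K : ℤ) (z : ℂ) : ((q : ℂ) ^ K) ^ z = (q : ℂ) ^ ((K : ℂ) * z) := by
  rw [Complex.cpow_int_mul' (by rw [Complex.natCast_arg, mul_zero]; exact neg_lt_zero.2 Real.pi_pos)
    (by rw [Complex.natCast_arg, mul_zero]; exact Real.pi_pos.le)]

/-- `q^{K s} = (q^{-s})^{−K}`: a Laurent monomial in ★ F1's variable `qVar q s = q^{-s}`. [cite: Casselman1980, §3] -/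
theorem natCast_cpow_intCast_mul_eq_qVar_zpow (q : ℕ) (K : ℤ) (s : ℂ) : (q : ℂ) ^ ((K : ℂ) * s) = qVar q s ^ (-K) := by
  rw [qVar_def, ← Complex.cpow_int_mul]
  congr 1
  push_cast
  ring

/-- **`s ↦ ((q^K : ℝ) : ℂ)^{s + c₀}` is `q^{-s}`-rational and regular at EVERY `s₀`** (`= q^{K c₀} · (q^{-s})^{−K}`; `q ≠ 0`).
[cite: Casselman1980, §3] [cite: KudlaSweet1997, §1] -/
theorem isQRationalRegularAt_zpow_cpow_add (hq : q ≠ 0) (K : ℤ) (c₀ s₀ : ℂ) :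
    IsQRationalRegularAt q s₀ fun s => (((q : ℝ) ^ K : ℝ) : ℂ) ^ (s + c₀) := by
  refine ((isQRationalRegularAt_qVar_zpow hq s₀ (-K)).const_mul ((q : ℂ) ^ ((K : ℂ) * c₀))).congr fun s => ?_
  show (q : ℂ) ^ ((K : ℂ) * c₀) * qVar q s ^ (-K) = (((q : ℝ) ^ K : ℝ) : ℂ) ^ (s + c₀)
  rw [ofReal_natCast_zpow, natCast_zpow_cpow, mul_add, Complex.cpow_add _ _ (Nat.cast_ne_zero.2 hq),
    natCast_cpow_intCast_mul_eq_qVar_zpow q K s, mul_comm]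

end Generic

/-! ## §2 At a finite place `v`: `‖·‖_w ∈ q_w^ℤ`, `|det_Δ p|_v ∈ q_v^ℤ`, `s ↦ localSiegelCharacter χ_v s p` is a Laurent monomial -/

section Place

variable (F : Type) [Field F] [NumberField F] (E : Type) [Field E] [NumberField E] [Algebra F E]
  [Algebra.IsQuadraticExtension F E] (c : E ≃ₐ[F] E)
  {δ : E} (hcδ : c δ = -δ) (hδ : δ ≠ 0) {d : F} (hd : δ * δ = algebraMap F E d)
  (v : HeightOneSpectrum (𝓞 F)) (n : ℕ) {T₀ : Matrix (Fin n) (Fin n) F} (hT₀ : T₀.IsSymm)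
  {JD : Matrix (Fin (n + n)) (Fin (n + n)) E} (hJD : JD = (gramD F n T₀).map (algebraMap F E))

omit [Algebra.IsQuadraticExtension F E] in
/-- Mathlib's norm on `E_w` is the normalised absolute value `normAbs` of the local field `E_w` (the tree's `norm_eq_coe_normAbs` of
`GlobalHeckeTheoryGL2OfCenterInvariant`, reproduced — as in ★ `LocalRingUnitModulusProduct` — to keep the import closure small). [folklore] -/
private theorem norm_eq_coe_normAbs' (w : HeightOneSpectrum (𝓞 E)) (x : w.adicCompletion E) :
    ‖x‖ = ((normAbs (w.adicCompletion E) x : ℝ≥0) : ℝ) := by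
  by_cases hx : x = 0
  · rw [hx, norm_zero, map_zero, NNReal.coe_zero]
  have hv : Valued.v x ≠ 0 := (Valuation.ne_zero_iff _).2 hx
  have hxn : Valued.v x = WithZero.exp (Multiplicative.toAdd (WithZero.unzero hv)) := by
    rw [WithZero.exp, ofAdd_toAdd, WithZero.coe_unzero]
  rw [FinitePlace.norm_def, WithZeroMulInt.toNNReal_neg_apply _ hv,
    normAbs_eq_inv_zpow_of_valued_eq w hxn, residueFieldCard_adicCompletion_eq, _root_.inv_zpow', neg_neg]
  rfl

omit [Algebra.IsQuadraticExtension F E] in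
/-- **`‖x‖_w = q_w^k` for some `k ∈ ℤ`** when `x ∈ E_w` is non-zero. [cite: BushnellHenniart2006, §1.1] -/
theorem exists_norm_eq_zpow (w : HeightOneSpectrum (𝓞 E)) {x : w.adicCompletion E} (hx : x ≠ 0) :
    ∃ k : ℤ, ‖x‖ = (residueFieldCard (w.adicCompletion E) : ℝ) ^ k := by
  obtain ⟨k, hk⟩ := exists_normAbs_eq_inv_zpow (F := w.adicCompletion E) hx
  refine ⟨-k, ?_⟩
  rw [norm_eq_coe_normAbs' E w x, hk]
  simp [zpow_neg]

omit [Algebra.IsQuadraticExtension F E] in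
/-- at `w ∣ v`: **`‖x‖_w = q_v^k` for some `k ∈ ℤ`** (`q_w = q_v^{f(w|v)}`, ★ (a) `residueFieldCard_placesOver_eq_pow`). [cite: BushnellHenniart2006, §1.1] -/
theorem exists_norm_eq_zpow_base (w : PlacesOver E v) {x : w.1.adicCompletion E} (hx : x ≠ 0) :
    ∃ k : ℤ, ‖x‖ = (residueFieldCard (v.adicCompletion F) : ℝ) ^ k := by
  obtain ⟨k, hk⟩ := exists_norm_eq_zpow E w.1 hx
  refine ⟨(w.1.asIdeal.inertiaDeg (𝓞 F) : ℤ) * k, ?_⟩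
  rw [hk, residueFieldCard_placesOver_eq_pow, Nat.cast_pow, zpow_mul, zpow_natCast]

omit [Algebra.IsQuadraticExtension F E] in
/-- a finite product of integer powers of `a ≠ 0` is `a` to the sum of the exponents. [folklore] -/
private theorem prod_eq_zpow_sum {ι : Type*} (S : Finset ι) {a : ℝ} (ha : a ≠ 0) (g : ι → ℝ) (k : ι → ℤ)
    (h : ∀ i ∈ S, g i = a ^ k i) : ∏ i ∈ S, g i = a ^ ∑ i ∈ S, k i := by
  classical
  induction S using Finset.induction_on with
  | empty => simp
  | insert i S hi ih =>
    rw [Finset.prod_insert hi, Finset.sum_insert hi, zpow_add₀ ha, h i (Finset.mem_insert_self i S),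
      ih fun j hj => h j (Finset.mem_insert_of_mem hj)]

/-- **`|det_Δ p|_v = q_v^K` for some `K ∈ ℤ`** when `p ∈ P_Δ(F_v)` (each `det_Δ p_w ∈ E_wˣ`, ★ `isUnit_detDelta`).
[cite: HarrisKudlaSweet1996, §1 (1.15)] -/
theorem exists_absDetDelta_eq_zpow {p : UnitaryGroup.localPi E c (n + n) JD v} (hp : IsSiegelDelta F E c hcδ hδ hd v n hT₀ hJD p) :
    ∃ K : ℤ, absDetDelta F E c v n p = (residueFieldCard (v.adicCompletion F) : ℝ) ^ K := by
  classical
  unfold absDetDelta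
  have h : ∀ w : PlacesOver E v, ∃ k : ℤ, ‖detDelta F E c v n w p‖ = (residueFieldCard (v.adicCompletion F) : ℝ) ^ k :=
    fun w => exists_norm_eq_zpow_base F E v w (isUnit_detDelta F E c hcδ hδ hd v n hT₀ hJD p hp w).ne_zero
  choose k hk using h
  exact ⟨∑ w, k w, prod_eq_zpow_sum _ (by exact_mod_cast residueFieldCard_ne_zero (v.adicCompletion F)) _ k fun w _ => hk w⟩

/-- **`s ↦ localSiegelCharacter χ_v s p = χ_v(det_Δ p) · |det_Δ p|_v^{s + n/2}` is a Laurent monomial in `q_v^{-s}`, hence `q_v^{-s}`-rational and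
regular at EVERY `s₀`**, for `p ∈ P_Δ(F_v)`. [cite: HarrisKudlaSweet1996, §1 (1.15)] [cite: KudlaSweet1997, §1] -/
theorem isQRationalRegularAt_localSiegelCharacter (χv : ∀ w : PlacesOver E v, (w.1.adicCompletion E)ˣ →* ℂˣ)
    {p : UnitaryGroup.localPi E c (n + n) JD v} (hp : IsSiegelDelta F E c hcδ hδ hd v n hT₀ hJD p) (s₀ : ℂ) :
    IsQRationalRegularAt (residueFieldCard (v.adicCompletion F)) s₀ fun s => localSiegelCharacter F E c v n χv s p := by
  obtain ⟨K, hK⟩ := exists_absDetDelta_eq_zpow F E c hcδ hδ hd v n hT₀ hJD hp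
  refine ((isQRationalRegularAt_zpow_cpow_add (residueFieldCard_ne_zero (v.adicCompletion F)) K ((n : ℂ) / 2) s₀).const_mul
    ((chiDet F E c v n χv p : ℂˣ) : ℂ)).congr fun s => ?_
  rw [localSiegelCharacter, hK]

end Place

/-! ## §3 Flat families: the Iwasawa factorisation of values, regularity of every value, one level for the family -/

section Flat

variable (F : Type) [Field F] [NumberField F] (E : Type) [Field E] [NumberField E] [Algebra F E]
  [Algebra.IsQuadraticExtension F E] (c : E ≃ₐ[F] E)
  {δ : E} (hcδ : c δ = -δ) (hδ : δ ≠ 0) {d : F} (hd : δ * δ = algebraMap F E d)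
  (v : HeightOneSpectrum (𝓞 F)) (n : ℕ) {T₀ : Matrix (Fin n) (Fin n) F} (hT₀ : T₀.IsSymm)
  {JD : Matrix (Fin (n + n)) (Fin (n + n)) E} (hJD : JD = (gramD F n T₀).map (algebraMap F E))
  (χv : ∀ w : PlacesOver E v, (w.1.adicCompletion E)ˣ →* ℂˣ)
  {f : ℂ → UnitaryGroup.localPi E c (n + n) JD v → ℂ}
  (hSieg : ∀ s, IsLocalSiegelSection F E c hcδ hδ hd v n hT₀ hJD χv s (f s))
  {K₀ : Subgroup (UnitaryGroup.localPi E c (n + n) JD v)}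
  (hflat : ∀ s s' : ℂ, ∀ k ∈ K₀, f s k = f s' k)

include hSieg hflat

/-- **Iwasawa factorisation of the values of a flat family**: `f s (p k) = localSiegelCharacter χ_v s p · f s₁ k` for `p ∈ P_Δ(F_v)`, `k ∈ K₀`
and ANY two parameters `s, s₁`. [cite: KudlaSweet1997, §1] [cite: HarrisKudlaSweet1996, §1 (1.15)] -/
theorem apply_eq_localSiegelCharacter_mul_of_flat {p : UnitaryGroup.localPi E c (n + n) JD v}
    (hp : IsSiegelDelta F E c hcδ hδ hd v n hT₀ hJD p) {k : UnitaryGroup.localPi E c (n + n) JD v} (hk : k ∈ K₀) (s s₁ : ℂ) :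
    f s (p * k) = localSiegelCharacter F E c v n χv s p * f s₁ k := by
  rw [hSieg s p hp k, hflat s s₁ k hk]

/-- **Every value of a flat family is a `q_v^{-s}`-monomial times a constant, hence regular at EVERY `s₀`**: under the Iwasawa decomposition
`H_v = P_Δ(F_v)·K₀`, `s ↦ f s h` is `q_v^{-s}`-rational and regular at `s₀` for every `h ∈ H_v` and every `s₀ ∈ ℂ` — the «entire input» that
★ B6 `K2LiuRankOneFamilies[Level]` and ★ `K2LiuRankOneOperators` consume at step 0 of the cocycle. [cite: KudlaSweet1997, §1] [cite: Casselman1980, §3] -/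
theorem isQRationalRegularAt_apply_of_flat
    (hIw : ∀ g : UnitaryGroup.localPi E c (n + n) JD v, ∃ p, IsSiegelDelta F E c hcδ hδ hd v n hT₀ hJD p ∧ ∃ k ∈ K₀, g = p * k)
    (h : UnitaryGroup.localPi E c (n + n) JD v) (s₀ : ℂ) :
    IsQRationalRegularAt (residueFieldCard (v.adicCompletion F)) s₀ fun s => f s h := by
  obtain ⟨p, hp, k, hk, rfl⟩ := hIw h
  refine ((isQRationalRegularAt_localSiegelCharacter F E c hcδ hδ hd v n hT₀ hJD χv hp s₀).mul
    (isQRationalRegularAt_const _ s₀ (f s₀ k))).congr fun s => ?_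
  exact (apply_eq_localSiegelCharacter_mul_of_flat F E c hcδ hδ hd v n hT₀ hJD χv hSieg hflat hp hk s s₀).symm

/-- **ONE LEVEL FOR THE WHOLE FAMILY.**  If `K₀` is open, `H_v = P_Δ(F_v)·K₀`, and ONE member `f s₁` is smooth, then there is an open subgroup
`K′ ≤ K₀` under which EVERY `f s` is right-invariant: `K′ := K₀ ⊓ U` for a smoothness group `U` of `f s₁`, since for `h = p k₀`, `k ∈ K′`,
`f s (p k₀ k) = χ_s(p) f s₁ (k₀ k) = χ_s(p) f s₁ k₀ = f s (p k₀)` — the `hfK` binder of ★ `K2LiuRankOneOperators`, uniformly in `s`.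
[cite: KudlaSweet1997, §1] [cite: BushnellHenniart2006, §1.1] -/
theorem exists_uniform_level (hK₀ : IsOpen (K₀ : Set (UnitaryGroup.localPi E c (n + n) JD v)))
    (hIw : ∀ g : UnitaryGroup.localPi E c (n + n) JD v, ∃ p, IsSiegelDelta F E c hcδ hδ hd v n hT₀ hJD p ∧ ∃ k ∈ K₀, g = p * k)
    {s₁ : ℂ} (hsm : IsSmooth F E c v n (f s₁)) :
    ∃ K' : OpenSubgroup (UnitaryGroup.localPi E c (n + n) JD v),
      (K' : Subgroup (UnitaryGroup.localPi E c (n + n) JD v)) ≤ K₀ ∧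
        ∀ (s : ℂ) (g : UnitaryGroup.localPi E c (n + n) JD v), ∀ k ∈ (K' : Subgroup (UnitaryGroup.localPi E c (n + n) JD v)),
          f s (g * k) = f s g := by
  obtain ⟨U, hU⟩ := hsm
  refine ⟨⟨K₀, hK₀⟩ ⊓ U, fun k hk => (by simpa [OpenSubgroup.coe_inf] using hk : k ∈ K₀ ∧ k ∈ (U : Subgroup _)).1, fun s g k hk => ?_⟩
  have hk' : k ∈ K₀ ∧ k ∈ (U : Subgroup _) := by simpa [OpenSubgroup.coe_inf] using hk
  obtain ⟨p, hp, k₀, hk₀, rfl⟩ := hIw g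
  rw [mul_assoc, apply_eq_localSiegelCharacter_mul_of_flat F E c hcδ hδ hd v n hT₀ hJD χv hSieg hflat hp (K₀.mul_mem hk₀ hk'.1) s s₁,
    hU k₀ k hk'.2, ← apply_eq_localSiegelCharacter_mul_of_flat F E c hcδ hδ hd v n hT₀ hJD χv hSieg hflat hp hk₀ s s₁]

/-- … in particular **every member of the family is smooth** as soon as one is (so the face's binder `∀ s, IsSmooth (f s)` is no stronger than
smoothness at a single parameter). [cite: KudlaSweet1997, §1] -/
theorem isSmooth_of_flat (hK₀ : IsOpen (K₀ : Set (UnitaryGroup.localPi E c (n + n) JD v)))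
    (hIw : ∀ g : UnitaryGroup.localPi E c (n + n) JD v, ∃ p, IsSiegelDelta F E c hcδ hδ hd v n hT₀ hJD p ∧ ∃ k ∈ K₀, g = p * k)
    {s₁ : ℂ} (hsm : IsSmooth F E c v n (f s₁)) (s : ℂ) : IsSmooth F E c v n (f s) := by
  obtain ⟨K', -, hK'⟩ := exists_uniform_level F E c hcδ hδ hd v n hT₀ hJD χv hSieg hflat hK₀ hIw hsm
  exact ⟨K', fun g k hk => hK' s g k hk⟩

end Flat

end Summit.HodgeConjecture.HodgeConjecture.Cruxes.HLiu418.K2LiuFlatSiegelFamilies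

end
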